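import Summits.ValiantsHypothesis.ValiantsHypothesis.Theorems.LacunarySymmetroidMatrixDescartesCensusV19SSoundSidon
import Summits.ValiantsHypothesis.ValiantsHypothesis.Theorems.LacunarySymmetroidMatrixDescartesCensusCaseCKit

/-!
# `MatrixDescartes` census — soundness of the 2-SIDON `V = 19` checker: a Case-B nineteen yields a model of its cell

HONEST FRAMING.  Object-search cell `pub-symmetroid`; door-A item `DoorA26 = PosRootLawAt 2 6 19`
(stmt-ValiantsHypothesis-19979; OPEN, typed, never asserted).  Part of the proof that certificates accepted by `V19S.certOK` (`…CensusV19SCheck`)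
exclude a nineteen on a 2-Sidon support: if a real symmetric six-term `2 × 2` pencil on a checked 2-Sidon support has `19` distinct positive
det-roots and its coefficient at position `z` VANISHES (Case B), then it is Descartes-sharp on the `20` live sums (`Census.caseC_support_eq`,
val-sym-door-p5 g3's …CaseCKit), the live coefficients alternate with the orientation of the lowest live one, the Newton-cone rows hold at
consecutive live triples (`Census.newton_cone_coeff`) in the checker's form `V19S.rowC25B`, and with the Gram facts of `…CensusV20SoundGram` and the
null-letter triangle (`Census.polarDet_triangle_pos_of_null`) this is a `V19S.Model` of the cell `(s, B z)` (`V19S.modelB_of_nineteen`).  Nothing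
here bears on the one-collision supports, on `ζ_sym(2,6)` over all supports, on `DoorA26` itself, on `MatrixDescartes` (stmt-ValiantsHypothesis-18050)
or on `VP ≠ VNP`.

[folklore] Certificate-checker soundness; elementary.
-/

-- the D-0017 layout repeats a namespace component (single-conjunct summit); the `dupNamespace` linter flags it; name mandated.
set_option linter.dupNamespace false

namespace Summit.ValiantsHypothesis.ValiantsHypothesis.Theorems.LacunarySymmetroidMatrixDescartes.Census.V19S

open V20 (Atom allAtoms psum posOf ordOK sums qA cA Term PolySpec posl FNat fval Row rowC25 FRat negAt Epos aval qv bv pdet dfun dist1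
  lprod fin6 ordOK_spec Epos_lt Epos_le Epos_posOf posOf_lt sums_nodup sums_getD getD_posOf negAt_succ
  G3poly RCSpoly Wpoly pval qA_mem cA_mem fin6_eq aval_qA aval_cA pval_G3 pval_RCS pval_W tri_pos)
open V19C (triNull_aval)

open Polynomial Finset
open scoped BigOperators Polynomial

section CaseB

variable {dl : List ℕ} {ord : List Atom} {S : Fin 6 → Matrix (Fin 2) (Fin 2) ℝ}

/-! ### Sign bookkeeping -/

/-- The sign pattern two positions on repeats. [folklore] -/
theorem negAt_add_two (s : Bool) (t : ℕ) : negAt s (t + 2) = negAt s t := by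
  rw [show t + 2 = t + 1 + 1 from rfl, negAt_succ, negAt_succ, Bool.not_not]

/-- Along the live positions of mode `B z` the cell's signs alternate. [folklore] -/
theorem negSlot_B_liveSlot_succ (s : Bool) (z i : ℕ) :
    negSlot s (.B z) (liveSlot z (i + 1)) = !negSlot s (.B z) (liveSlot z i) := by
  unfold negSlot liveSlot Mode.pivot
  by_cases h1 : i + 1 < z
  · rw [if_pos h1, if_pos (show i < z by omega), if_pos (show i + 1 ≤ z by omega), if_pos (show i ≤ z by omega), negAt_succ]
  · rw [if_neg h1]
    by_cases h2 : i < z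
    · have hz : z = i + 1 := by omega
      subst hz
      rw [if_pos h2, if_neg (show ¬ i + 1 + 1 ≤ i + 1 by omega), if_pos (show i ≤ i + 1 by omega), negAt_add_two]
    · rw [if_neg h2, if_neg (show ¬ i + 1 + 1 ≤ z by omega), if_neg (show ¬ i + 1 ≤ z by omega),
        show i + 1 + 1 = i + 1 + 1 from rfl, negAt_succ s (i + 1), Bool.not_not]

/-- The first live position carries the sign `s`. [folklore] -/
theorem negSlot_B_liveSlot_zero (s : Bool) (z : ℕ) : negSlot s (.B z) (liveSlot z 0) = !s := by
  unfold negSlot liveSlot Mode.pivot negAt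
  by_cases h : 0 < z
  · rw [if_pos h, if_pos (show 0 ≤ z by omega)]; simp
  · rw [if_neg h, if_neg (show ¬ 0 + 1 ≤ z by omega)]; simp

/-- The real sign of a live position of a mode-`B z` cell. [folklore] -/
theorem sgR_B_of_ne {s : Bool} {z p : ℕ} {mid : Option ℕ} (hp : p ≠ z) :
    sgR (mkCtx dl ord s (.B z) mid) p = if negSlot s (.B z) p then -1 else 1 := by
  unfold sgR mkCtx zeroSlot; simp [hp]

/-- The real sign of the dead position of a mode-`B z` cell is `0`. [folklore] -/
theorem sgR_B_self {s : Bool} {z : ℕ} {mid : Option ℕ} : sgR (mkCtx dl ord s (.B z) mid) z = 0 := by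
  unfold sgR mkCtx zeroSlot; simp

/-- A `±1`-valued `if`. [folklore] -/
theorem ite_pm_cases (b : Bool) : (if b then (-1 : ℝ) else 1) = 1 ∨ (if b then (-1 : ℝ) else 1) = -1 := by
  cases b <;> simp

/-- Negating the Boolean negates the `±1`. [folklore] -/
theorem ite_pm_not (b : Bool) : (if (!b) then (-1 : ℝ) else 1) = -(if b then (-1 : ℝ) else 1) := by
  cases b <;> simp

/-- Sign chaining along an alternating pair. [folklore] -/
theorem chain_alt {σ a b : ℝ} (hσ : σ = 1 ∨ σ = -1) (h : 0 < σ * a) (hab : a * b < 0) : 0 < -σ * b := by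
  rcases hσ with rfl | rfl <;> nlinarith

/-- Sign chaining along a repeated pair. [folklore] -/
theorem chain_rep {σ a b : ℝ} (hσ : σ = 1 ∨ σ = -1) (h : 0 < σ * a) (hab : 0 < a * b) : 0 < σ * b := by
  rcases hσ with rfl | rfl <;> nlinarith

/-- A real of sign `σ = ±1` is `σ · |y|`. [folklore] -/
theorem eq_sgn_mul_abs {σ y : ℝ} (hσ : σ = 1 ∨ σ = -1) (h : 0 < σ * y) : y = σ * |y| := by
  rcases hσ with rfl | rfl
  · rw [one_mul] at h; rw [one_mul, abs_of_pos h]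
  · have : y < 0 := by linarith
    rw [abs_of_neg this]; ring

/-! ### The support of a Case-B nineteen -/

/-- A Case-B nineteen has support exactly the `20` live sums. [folklore] -/
theorem supportB_eq (h : ordOK dl ord = true) (h19 : 19 ≤ ((pdet dl S).roots.toFinset.filter (fun t => 0 < t)).card)
    {z : ℕ} (hz : z < 21) (hcz : (pdet dl S).coeff (Epos dl ord z) = 0) :
    (pdet dl S).support = ((sums dl ord).eraseIdx z).toFinset := by
  rw [toFinset_live h hz]
  refine support_eq_erase_of_coeff_eq_zero _ _ (card_toFinset_sums h) (support_subset_sums h S) h19 ?_ hcz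
  rw [← sums_getD h hz, List.mem_toFinset, List.getD_eq_getElem _ _ (by rw [length_sums h]; exact hz)]
  exact List.getElem_mem _

/-- A Case-B nineteen is Descartes-sharp on the live sums. [folklore] -/
theorem sharpB (h : ordOK dl ord = true) (h19 : 19 ≤ ((pdet dl S).roots.toFinset.filter (fun t => 0 < t)).card)
    {z : ℕ} (hz : z < 21) (hcz : (pdet dl S).coeff (Epos dl ord z) = 0) :
    (pdet dl S).support.card ≤ ((pdet dl S).roots.toFinset.filter (fun t => 0 < t)).card + 1 := by
  rw [supportB_eq h h19 hz hcz, card_toFinset_live h hz]; omega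

/-- Every live sum is in the support of a Case-B nineteen. [folklore] -/
theorem live_mem_support (h : ordOK dl ord = true) (h19 : 19 ≤ ((pdet dl S).roots.toFinset.filter (fun t => 0 < t)).card)
    {z : ℕ} (hz : z < 21) (hcz : (pdet dl S).coeff (Epos dl ord z) = 0) {i : ℕ} (hi : i < 20) :
    Epos dl ord (liveSlot z i) ∈ (pdet dl S).support := by
  rw [supportB_eq h h19 hz hcz, List.mem_toFinset, ← live_getD h z hi, List.getD_eq_getElem _ _ (by rw [length_live h hz]; exact hi)]
  exact List.getElem_mem _

/-- Live coefficients of a Case-B nineteen do not vanish. [folklore] -/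
theorem coeff_live_ne_zero (h : ordOK dl ord = true) (h19 : 19 ≤ ((pdet dl S).roots.toFinset.filter (fun t => 0 < t)).card)
    {z : ℕ} (hz : z < 21) (hcz : (pdet dl S).coeff (Epos dl ord z) = 0) {i : ℕ} (hi : i < 20) :
    (pdet dl S).coeff (Epos dl ord (liveSlot z i)) ≠ 0 :=
  Polynomial.mem_support_iff.1 (live_mem_support h h19 hz hcz hi)

/-- A support element of a Case-B nineteen is a live sum. [folklore] -/
theorem exists_live_of_mem_support (h : ordOK dl ord = true) (h19 : 19 ≤ ((pdet dl S).roots.toFinset.filter (fun t => 0 < t)).card)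
    {z : ℕ} (hz : z < 21) (hcz : (pdet dl S).coeff (Epos dl ord z) = 0) {e : ℕ} (he : e ∈ (pdet dl S).support) :
    ∃ j, j < 20 ∧ Epos dl ord (liveSlot z j) = e := by
  rw [supportB_eq h h19 hz hcz, List.mem_toFinset] at he
  obtain ⟨j, hj, rfl⟩ := List.getElem_of_mem he
  rw [length_live h hz] at hj
  exact ⟨j, hj, by rw [← live_getD h z hj, List.getD_eq_getElem _ _ (by rw [length_live h hz]; exact hj)]⟩

/-- Consecutive live coefficients of a Case-B nineteen alternate. [folklore] -/
theorem coeff_live_alternate (h : ordOK dl ord = true) (h19 : 19 ≤ ((pdet dl S).roots.toFinset.filter (fun t => 0 < t)).card)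
    {z : ℕ} (hz : z < 21) (hcz : (pdet dl S).coeff (Epos dl ord z) = 0) {i : ℕ} (hi : i + 1 < 20) :
    (pdet dl S).coeff (Epos dl ord (liveSlot z i)) * (pdet dl S).coeff (Epos dl ord (liveSlot z (i + 1))) < 0 := by
  refine coeff_mul_coeff_neg_of_sharp _ (sharpB h h19 hz hcz) (live_mem_support h h19 hz hcz (by omega))
    (live_mem_support h h19 hz hcz hi) (Epos_lt h (liveSlot_lt_liveSlot (Nat.lt_succ_self i)) (liveSlot_lt hi)) ?_
  intro u hu ⟨h1, h2⟩
  obtain ⟨j, hj, rfl⟩ := exists_live_of_mem_support h h19 hz hcz hu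
  have hij : liveSlot z i < liveSlot z j := by
    by_contra hle; push Not at hle
    exact absurd h1 (not_lt.2 (Epos_le h hle (liveSlot_lt (by omega))))
  have hji : liveSlot z j < liveSlot z (i + 1) := by
    by_contra hle; push Not at hle
    exact absurd h2 (not_lt.2 (Epos_le h hle (liveSlot_lt hj)))
  have h3 : i < j := by
    by_contra hle; push Not at hle
    rcases hle.eq_or_lt with rfl | hlt
    · exact lt_irrefl _ hij
    · exact absurd (liveSlot_lt_liveSlot (z := z) hlt) (not_lt.2 hij.le)
  have h4 : j < i + 1 := by
    by_contra hle; push Not at hle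
    rcases hle.eq_or_lt with rfl | hlt
    · exact lt_irrefl _ hji
    · exact absurd (liveSlot_lt_liveSlot (z := z) hlt) (not_lt.2 hji.le)
  omega

/-- **Sign pattern of a Case-B nineteen**: with `s` the sign of the lowest live coefficient, the live coefficient at position `p` has the
cell's sign `V19S.sgR (s, B z) p`. [folklore] -/
theorem signB (h : ordOK dl ord = true) (h19 : 19 ≤ ((pdet dl S).roots.toFinset.filter (fun t => 0 < t)).card)
    {z : ℕ} (hz : z < 21) (hcz : (pdet dl S).coeff (Epos dl ord z) = 0) :
    ∀ i, i < 20 → 0 < sgR (mkCtx dl ord (decide (0 < (pdet dl S).coeff (Epos dl ord (liveSlot z 0)))) (.B z) none) (liveSlot z i)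
      * (pdet dl S).coeff (Epos dl ord (liveSlot z i)) := by
  intro i
  induction i with
  | zero =>
    intro _
    rw [sgR_B_of_ne (liveSlot_ne z 0), negSlot_B_liveSlot_zero]
    have hne := coeff_live_ne_zero h h19 hz hcz (show 0 < 20 by norm_num)
    generalize (pdet dl S).coeff (Epos dl ord (liveSlot z 0)) = c0 at hne ⊢
    by_cases hc : 0 < c0
    · rw [decide_eq_true hc]; simp [hc]
    · have hlt : c0 < 0 := lt_of_le_of_ne (not_lt.1 hc) hne
      rw [decide_eq_false hc]; simp; linarith
  | succ i ih =>
    intro hi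
    have h1 := ih (by omega)
    have h2 := coeff_live_alternate h h19 hz hcz hi
    rw [sgR_B_of_ne (liveSlot_ne z _)] at h1 ⊢
    rw [negSlot_B_liveSlot_succ, ite_pm_not]
    exact chain_alt (ite_pm_cases _) h1 h2

/-! ### The Newton-cone rows on the live sums -/

/-- The row `rowC25B E z t` holds for magnitudes whose live values are the absolute live coefficients. [folklore] -/
theorem rowC25B_of_nineteen (h : ordOK dl ord = true) (h19 : 19 ≤ ((pdet dl S).roots.toFinset.filter (fun t => 0 < t)).card)
    {z : ℕ} (hz : z < 21) (hcz : (pdet dl S).coeff (Epos dl ord z) = 0) (x : ℕ → ℝ)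
    (hx : ∀ i, i < 20 → x (liveSlot z i) = |(pdet dl S).coeff (Epos dl ord (liveSlot z i))|) {t : ℕ} (h1 : 1 ≤ t) (h18 : t ≤ 18) :
    (rowC25B (sums dl ord) z t).Holds x := by
  have hH : (rowC25 ((sums dl ord).eraseIdx z) t).Holds (x ∘ liveSlot z) := by
    have hpq := Epos_lt h (liveSlot_lt_liveSlot (z := z) (show t - 1 < t by omega)) (liveSlot_lt (show t < 20 by omega))
    have hqr := Epos_lt h (liveSlot_lt_liveSlot (z := z) (show t < t + 1 by omega)) (liveSlot_lt (show t + 1 < 20 by omega))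
    have newton := newton_cone_coeff (pdet dl S) (sharpB h h19 hz hcz) (live_mem_support h h19 hz hcz (show t - 1 < 20 by omega))
      (live_mem_support h h19 hz hcz (show t < 20 by omega)) (live_mem_support h h19 hz hcz (show t + 1 < 20 by omega)) hpq hqr
    rw [supportB_eq h h19 hz hcz, prod_erase_abs_eq _ (live_nodup h z), prod_erase_abs_eq _ (live_nodup h z),
      prod_erase_abs_eq _ (live_nodup h z)] at newton
    refine rowC25_holds_of_ineq _ t (x ∘ liveSlot z) (live_getD h z (by omega)) (live_getD h z (by omega)) (live_getD h z (by omega))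
      hpq hqr ?_
    simp only [Function.comp]
    rw [hx (t - 1) (by omega), hx t (by omega), hx (t + 1) (by omega)]
    exact newton
  unfold Row.Holds at hH ⊢
  unfold rowC25B
  simp only
  rw [lprod_map, lprod_map]
  exact hH

/-! ### The model of a Case-B nineteen -/

/-- Every live position is `liveSlot z i` for a live index `i < 20`. [folklore] -/
theorem exists_liveSlot_eq {z p : ℕ} (hz : z < 21) (hp : p < 21) (hpz : p ≠ z) : ∃ i, i < 20 ∧ liveSlot z i = p := by
  by_cases hlt : p < z
  · exact ⟨p, by omega, by unfold liveSlot; rw [if_pos hlt]⟩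
  · exact ⟨p - 1, by omega, by unfold liveSlot; rw [if_neg (by omega)]; omega⟩

/-- **A Case-B nineteen yields a model** of the cell `(s, B z)`, `s` = sign of the lowest live coefficient, branch `none`. [folklore] -/
theorem modelB_of_nineteen (h : ordOK dl ord = true) (hS : ∀ l, (S l).IsSymm)
    (h19 : 19 ≤ ((pdet dl S).roots.toFinset.filter (fun t => 0 < t)).card)
    {z : ℕ} (hz : z < 21) (hcz : (pdet dl S).coeff (Epos dl ord z) = 0) :
    Model (mkCtx dl ord (decide (0 < (pdet dl S).coeff (Epos dl ord (liveSlot z 0)))) (.B z) none)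
      (fun p => if p < 21 ∧ p ≠ z then |(pdet dl S).coeff (Epos dl ord p)| else 1) (aval S) := by
  set s := decide (0 < (pdet dl S).coeff (Epos dl ord (liveSlot z 0))) with hs
  set x : ℕ → ℝ := fun p => if p < 21 ∧ p ≠ z then |(pdet dl S).coeff (Epos dl ord p)| else 1 with hxdef
  have hxl : ∀ i, i < 20 → x (liveSlot z i) = |(pdet dl S).coeff (Epos dl ord (liveSlot z i))| := by
    intro i hi; rw [hxdef]; simp only; rw [if_pos ⟨liveSlot_lt hi, liveSlot_ne z i⟩]
  have xpos : ∀ t, 0 < x t := by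
    intro t; rw [hxdef]; simp only
    split_ifs with ht
    · obtain ⟨i, hi, rfl⟩ := exists_liveSlot_eq hz ht.1 ht.2
      exact abs_pos.2 (coeff_live_ne_zero h h19 hz hcz hi)
    · exact one_pos
  refine
    { wf := ⟨h, rfl, by simp only [mkCtx, Mode.ok, decide_eq_true_eq]; omega⟩
      xpos := xpos
      hv := ?_
      c25A := fun k t hk => by simp [mkCtx] at hk
      c25B := ?_
      winLow := fun k hk => by simp [mkCtx] at hk
      winHigh := fun k hk => by simp [mkCtx] at hk
      winMid := fun k hk => by simp [mkCtx] at hk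
      g3 := fun i j k hij hjk _ => pval_G3 S hij hjk
      rcs := fun i j _ _ hij hq => pval_RCS S hij hq
      w := fun i j k l _ _ _ _ hij hik hil hjk hjl hkl => pval_W S hij hik hil hjk hjl hkl
      tri := fun i j k hij hjk _ hi hj hk => tri_pos S hij hjk hi hj hk
      triNull := fun n a b _ hab _ hna hnb hn ha hb hne => triNull_aval S hna hab.ne hnb hn ha hb hne }
  · -- hv
    intro a ha
    show aval S a = sgR _ (posOf a ord) * x (posOf a ord)
    have hp := posOf_lt h ha
    rw [← coeff_Epos_posOf h hS ha]
    by_cases hpz : posOf a ord = z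
    · rw [hpz, sgR_B_self, zero_mul, hcz]
    · obtain ⟨i, hi, hip⟩ := exists_liveSlot_eq hz hp hpz
      have key := signB h h19 hz hcz i hi
      rw [hip] at key
      rw [hxdef]; simp only; rw [if_pos ⟨hp, hpz⟩]
      rw [sgR_B_of_ne hpz] at key ⊢
      exact eq_sgn_mul_abs (ite_pm_cases _) key
  · -- c25B
    intro z' t hz' h1 h18
    simp only [mkCtx, Mode.B.injEq] at hz'
    subst hz'
    exact rowC25B_of_nineteen h h19 hz hcz x hxl h1 h18

end CaseB

end Summit.ValiantsHypothesis.ValiantsHypothesis.Theorems.LacunarySymmetroidMatrixDescartes.Census.V19S
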